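import Summits.CriticalPhenomena.PercolationContinuityZ3.Theorems.PercNearOneGluingNoHeavyLowerTailFrontierDecRowsHubStripping
import HarnessLib

/-!
# HUB STRIPPING, II: hub-less members suffice; the cyclically decorated 3PT-LB family; row 37 of `…FrontierDecRowsLeFive` for all `n`
# from its hub-less members

Support file (prover seat `prim-l12-p1`, gen 4, P1 line; `--supports stmt-CriticalPhenomena-4575`).  No named facts, no sorries, no
`native_decide`, no new definitions.  Sequel of `…FrontierDecRowsHubStripping` (Theorem 1 there: `HubStripping.sahiE3_hubEdge`, the exact
Bernstein decomposition of Sahi's `E₃` at a hub edge of a pairwise-nested triple of group separations `D[X|Y] = connEvent (sep X Y)`, `X, Y` vertex lists).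

**Theorem 2 (`nonneg_of_hubless_class`, hub stripping).**  Let `K` be a class of near-side triples `(X₁,X₂,X₃)` (far sides `Y_i` fixed) that is
pairwise nested, closed under enlarging any `X_i` by a vertex, and closed under deleting the hub set `T = X₁∩X₂∩X₃` when `T` avoids `Y₁∪Y₂∪Y₃`.
If `E₃ ≥ 0` for every weight function and every HUB-LESS member of `K`, then `E₃ ≥ 0` for every member of `K`.
PROOF: induction on the number of pairs of positive weight.  A hub with a positive-weight edge: Theorem 1 writes `E₃` as a combination with
nonnegative coefficients of eight `K`-rows under `w[e↦0]` (one positive pair fewer).  Otherwise every hub is almost surely isolated (`ae_good` of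
`…TerminalEdgeInduction`), so either some hub lies in some `Y_i` (that event is empty, `E₃ = 0`) or deleting the hubs from the `X_i` does not change the
events almost surely (`sahiE3_congr_ae`) and the hub-less hypothesis applies.  ∎
**Corollaries.**  `nonneg_of_hubless` (the class of ALL pairwise-nested triples); `cyc_nonneg_of_hubless`: for the CYCLICALLY DECORATED 3PT-LB family
  `CYC(P,Q,R) = E₃(D[P|c], D[Q|y], D[R|b])`, `b ∈ P`, `c ∈ Q`, `y ∈ R`
(`P = {b}, Q = {c}, R = {y}`: 3PT-LB; one decoration: hybrid 3PT-LB rows (`HybridThreePointLB`); `P={a,b}, Q={a,c}, R={y}`: row 15; `P={a,b},Q={a,c},R={a,y}`: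
row 37 of `…FrontierDecRowsLeFive` — the two pairwise-nested rows among the seven open four-point decreasing frontier rows 12,15,27,30,36,37,44), nonnegativity
of the HUB-LESS members (`P ∩ Q ∩ R = ∅`) implies nonnegativity of all members; in particular (`frontier_37_of_cyc_hubless`) row 37 holds for ALL `n` as
soon as the hub-less cyclically decorated 3PT-LB rows do (row 15 is the smallest hub-less member that is not a hybrid row).  Nothing is claimed about the
hub-less members themselves: they are OPEN beyond the hybrid rows (census-clean: prim-l12-p1 gen 4, work/cpn; ttrl request filed).
-/

noncomputable section

namespace Summit.CriticalPhenomena.PercolationContinuityZ3.Theorems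

namespace HubStripping

open MeasureTheory Literature.Probability.Percolation Literature.Probability.LatticeModels
open EdgeInduction TerminalEdgeInduction CovTransferCert E3GroupSepCert
open scoped Classical

variable {n : ℕ}

/-! ### Theorem 2: hub stripping ("hub-less members suffice") -/

/-- `E₃` with an empty first event vanishes. [folklore] -/
theorem sahiE3_empty₁ (μ : Measure (BondConfig (Fin n))) (B C : Set (BondConfig (Fin n))) : sahiE3 μ ∅ B C = 0 := by
  simp [sahiE3]

/-- `E₃` with an empty second event vanishes. [folklore] -/
theorem sahiE3_empty₂ (μ : Measure (BondConfig (Fin n))) (A C : Set (BondConfig (Fin n))) : sahiE3 μ A ∅ C = 0 := by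
  simp [sahiE3]

/-- `E₃` with an empty third event vanishes. [folklore] -/
theorem sahiE3_empty₃ (μ : Measure (BondConfig (Fin n))) (A B : Set (BondConfig (Fin n))) : sahiE3 μ A B ∅ = 0 := by
  simp [sahiE3]

/-- Setting a positive weight to zero lowers the number of positive-weight pairs. [folklore] -/
theorem card_pos_update_lt (w : Sym2 (Fin n) → unitInterval) {e : Sym2 (Fin n)} (he : w e ≠ 0) :
    (Finset.univ.filter fun e' : Sym2 (Fin n) => Function.update w e 0 e' ≠ 0).card <
      (Finset.univ.filter fun e' : Sym2 (Fin n) => w e' ≠ 0).card := by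
  apply Finset.card_lt_card
  refine (Finset.ssubset_iff_of_subset ?_).2 ⟨e, by simp [he], by simp⟩
  intro e' he'
  simp only [Finset.mem_filter, Finset.mem_univ, true_and] at he' ⊢
  by_cases h : e' = e
  · subst h
    simp at he'
  · rwa [Function.update_of_ne h] at he'

/-- On `good w`, a vertex all of whose pairs have weight zero is joined to no other vertex. [folklore] -/
theorem eq_of_reachable_of_isolated {w : Sym2 (Fin n) → unitInterval} {ω : BondConfig (Fin n)} (hω : ω ∈ good w)
    {t : Fin n} (ht : ∀ z, z ≠ t → w s(t, z) = 0) {q : Fin n} (h : (openGraph ω).Reachable t q) : t = q := by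
  by_contra hne
  obtain ⟨p⟩ := h
  cases p with
  | nil => exact hne rfl
  | cons hadj _ =>
    rename_i v _
    have h1 := (openGraph_adj ω t v).1 hadj
    exact (hω s(t, v)).2 (ht v h1.2.symm) h1.1

/-- Deleting almost surely isolated vertices (off `Y`) from the near side does not change `D[X|Y]` almost surely. [this work] -/
theorem csep_strip_ae_eq (w : Sym2 (Fin n) → unitInterval) {X X' Y : List (Fin n)} (hub : Fin n → Prop)
    (hX' : ∀ v, v ∈ X' ↔ v ∈ X ∧ ¬ hub v) (hT : ∀ t, hub t → ∀ z, z ≠ t → w s(t, z) = 0) (hTY : ∀ t, hub t → t ∉ Y) :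
    connEvent (sep X Y) =ᵐ[prodBernoulli w] connEvent (sep X' Y) := by
  refine Filter.eventuallyEq_set.2 ?_
  filter_upwards [ae_good w] with ω hω
  rw [mem_csep, mem_csep]
  constructor
  · exact fun h p hp q hq => h p ((hX' p).1 hp).1 q hq
  · intro h p hp q hq hR
    by_cases hpT : hub p
    · have hpq : p = q := eq_of_reachable_of_isolated hω (hT p hpT) hR
      exact hTY p hpT (by rw [hpq]; exact hq)
    · exact h p ((hX' p).2 ⟨hp, hpT⟩) q hq hR

/-- **Hub stripping (class form).**  `K` is a class of near-side triples of vertex lists (the far sides `Y₁ Y₂ Y₃` are fixed) which is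
pairwise nested, closed under prepending a vertex to any near side, and closed under deleting the hubs (the vertices common to the three
near sides) when no hub lies on a far side.  If `E₃(D[X₁|Y₁], D[X₂|Y₂], D[X₃|Y₃]) ≥ 0` for every weight function and every HUB-LESS member
of `K`, then it is `≥ 0` for every member of `K`.  Proof: induction on the number of positive-weight pairs, using `sahiE3_hubEdge` at a hub
with a positive-weight pair; when every hub is (almost surely) isolated, either some hub lies on a far side (an empty event, `E₃ = 0`) or the
hubs can be deleted almost surely. [this work] -/
theorem nonneg_of_hubless_class (Y₁ Y₂ Y₃ : List (Fin n)) (K : List (Fin n) → List (Fin n) → List (Fin n) → Prop)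
    (hPN : ∀ X₁ X₂ X₃, K X₁ X₂ X₃ → (Y₁ ⊆ X₂ ∨ Y₂ ⊆ X₁) ∧ (Y₁ ⊆ X₃ ∨ Y₃ ⊆ X₁) ∧ (Y₂ ⊆ X₃ ∨ Y₃ ⊆ X₂))
    (hins₁ : ∀ X₁ X₂ X₃ (z : Fin n), K X₁ X₂ X₃ → K (z :: X₁) X₂ X₃)
    (hins₂ : ∀ X₁ X₂ X₃ (z : Fin n), K X₁ X₂ X₃ → K X₁ (z :: X₂) X₃)
    (hins₃ : ∀ X₁ X₂ X₃ (z : Fin n), K X₁ X₂ X₃ → K X₁ X₂ (z :: X₃))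
    (hstrip : ∀ X₁ X₂ X₃ X₁' X₂' X₃' : List (Fin n), K X₁ X₂ X₃ →
      (∀ t, t ∈ X₁ ∧ t ∈ X₂ ∧ t ∈ X₃ → t ∉ Y₁ ∧ t ∉ Y₂ ∧ t ∉ Y₃) →
      (∀ v, v ∈ X₁' ↔ v ∈ X₁ ∧ ¬ (v ∈ X₁ ∧ v ∈ X₂ ∧ v ∈ X₃)) →
      (∀ v, v ∈ X₂' ↔ v ∈ X₂ ∧ ¬ (v ∈ X₁ ∧ v ∈ X₂ ∧ v ∈ X₃)) →
      (∀ v, v ∈ X₃' ↔ v ∈ X₃ ∧ ¬ (v ∈ X₁ ∧ v ∈ X₂ ∧ v ∈ X₃)) → K X₁' X₂' X₃')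
    (H : ∀ (w : Sym2 (Fin n) → unitInterval) (X₁ X₂ X₃ : List (Fin n)), K X₁ X₂ X₃ → (∀ v ∈ X₁, v ∈ X₂ → v ∉ X₃) →
      0 ≤ sahiE3 (prodBernoulli w) (connEvent (sep X₁ Y₁)) (connEvent (sep X₂ Y₂)) (connEvent (sep X₃ Y₃)))
    (w : Sym2 (Fin n) → unitInterval) (X₁ X₂ X₃ : List (Fin n)) (hK : K X₁ X₂ X₃) :
    0 ≤ sahiE3 (prodBernoulli w) (connEvent (sep X₁ Y₁)) (connEvent (sep X₂ Y₂)) (connEvent (sep X₃ Y₃)) := by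
  suffices key : ∀ (N : ℕ) (w : Sym2 (Fin n) → unitInterval) (X₁ X₂ X₃ : List (Fin n)), K X₁ X₂ X₃ →
      (Finset.univ.filter fun e : Sym2 (Fin n) => w e ≠ 0).card = N →
      0 ≤ sahiE3 (prodBernoulli w) (connEvent (sep X₁ Y₁)) (connEvent (sep X₂ Y₂)) (connEvent (sep X₃ Y₃)) from
    key _ w X₁ X₂ X₃ hK rfl
  intro N
  induction N using Nat.strong_induction_on with
  | _ N ih =>
  intro w X₁ X₂ X₃ hK hN
  obtain ⟨n₁₂, n₁₃, n₂₃⟩ := hPN X₁ X₂ X₃ hK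
  by_cases hex : ∃ t z : Fin n, t ∈ X₁ ∧ t ∈ X₂ ∧ t ∈ X₃ ∧ z ≠ t ∧ w s(t, z) ≠ 0
  · -- a hub with a positive-weight pair: strip that pair
    obtain ⟨t, z, ht₁, ht₂, ht₃, -, hw⟩ := hex
    rw [sahiE3_hubEdge w t z X₁ Y₁ X₂ Y₂ X₃ Y₃ ht₁ ht₂ ht₃ n₁₂ n₁₃ n₂₃]
    have hlt : (Finset.univ.filter fun e : Sym2 (Fin n) => Function.update w s(t, z) 0 e ≠ 0).card < N :=
      hN ▸ card_pos_update_lt w hw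
    have I : ∀ X₁' X₂' X₃' : List (Fin n), K X₁' X₂' X₃' →
        0 ≤ sahiE3 (prodBernoulli (Function.update w s(t, z) 0)) (connEvent (sep X₁' Y₁)) (connEvent (sep X₂' Y₂))
          (connEvent (sep X₃' Y₃)) :=
      fun X₁' X₂' X₃' hK' => ih _ hlt _ X₁' X₂' X₃' hK' rfl
    have hp0 : (0 : ℝ) ≤ w s(t, z) := (w s(t, z)).2.1
    have hq0 : (0 : ℝ) ≤ 1 - w s(t, z) := sub_nonneg.2 (w s(t, z)).2.2
    have k1 := hins₁ _ _ _ z hK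
    have k2 := hins₂ _ _ _ z hK
    have k3 := hins₃ _ _ _ z hK
    have k12 := hins₂ _ _ _ z k1
    have k13 := hins₃ _ _ _ z k1
    have k23 := hins₃ _ _ _ z k2
    have k123 := hins₃ _ _ _ z k12
    apply add_nonneg (add_nonneg (add_nonneg ?_ ?_) ?_) ?_
    · exact mul_nonneg (pow_nonneg hq0 3) (I _ _ _ hK)
    · exact mul_nonneg (mul_nonneg hp0 (pow_nonneg hq0 2))
        (add_nonneg (add_nonneg (I _ _ _ k1) (I _ _ _ k2)) (I _ _ _ k3))
    · exact mul_nonneg (mul_nonneg (pow_nonneg hp0 2) hq0)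
        (add_nonneg (add_nonneg (I _ _ _ k12) (I _ _ _ k13)) (I _ _ _ k23))
    · exact mul_nonneg (pow_nonneg hp0 3) (I _ _ _ k123)
  · -- every hub is almost surely isolated
    push Not at hex
    have hiso : ∀ t, (t ∈ X₁ ∧ t ∈ X₂ ∧ t ∈ X₃) → ∀ z, z ≠ t → w s(t, z) = 0 :=
      fun t ht z hz => hex t z ht.1 ht.2.1 ht.2.2 hz
    by_cases hY : ∃ t, (t ∈ X₁ ∧ t ∈ X₂ ∧ t ∈ X₃) ∧ (t ∈ Y₁ ∨ t ∈ Y₂ ∨ t ∈ Y₃)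
    · obtain ⟨t, ht, h | h | h⟩ := hY
      · rw [csep_eq_empty_of_mem ht.1 h, sahiE3_empty₁]
      · rw [csep_eq_empty_of_mem ht.2.1 h, sahiE3_empty₂]
      · rw [csep_eq_empty_of_mem ht.2.2 h, sahiE3_empty₃]
    · push Not at hY
      have hX₁' : ∀ v, v ∈ X₁.filter (fun v => decide ¬ (v ∈ X₁ ∧ v ∈ X₂ ∧ v ∈ X₃)) ↔
          v ∈ X₁ ∧ ¬ (v ∈ X₁ ∧ v ∈ X₂ ∧ v ∈ X₃) := fun v => by simp only [List.mem_filter, decide_eq_true_eq]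
      have hX₂' : ∀ v, v ∈ X₂.filter (fun v => decide ¬ (v ∈ X₁ ∧ v ∈ X₂ ∧ v ∈ X₃)) ↔
          v ∈ X₂ ∧ ¬ (v ∈ X₁ ∧ v ∈ X₂ ∧ v ∈ X₃) := fun v => by simp only [List.mem_filter, decide_eq_true_eq]
      have hX₃' : ∀ v, v ∈ X₃.filter (fun v => decide ¬ (v ∈ X₁ ∧ v ∈ X₂ ∧ v ∈ X₃)) ↔
          v ∈ X₃ ∧ ¬ (v ∈ X₁ ∧ v ∈ X₂ ∧ v ∈ X₃) := fun v => by simp only [List.mem_filter, decide_eq_true_eq]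
      have e₁ := csep_strip_ae_eq w (Y := Y₁) (fun v => v ∈ X₁ ∧ v ∈ X₂ ∧ v ∈ X₃) hX₁' hiso fun t ht => (hY t ht).1
      have e₂ := csep_strip_ae_eq w (Y := Y₂) (fun v => v ∈ X₁ ∧ v ∈ X₂ ∧ v ∈ X₃) hX₂' hiso fun t ht => (hY t ht).2.1
      have e₃ := csep_strip_ae_eq w (Y := Y₃) (fun v => v ∈ X₁ ∧ v ∈ X₂ ∧ v ∈ X₃) hX₃' hiso fun t ht => (hY t ht).2.2
      rw [sahiE3_congr_ae e₁ e₂ e₃]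
      refine H w _ _ _ (hstrip X₁ X₂ X₃ _ _ _ hK hY hX₁' hX₂' hX₃') ?_
      intro v hv1 hv2 hv3
      exact ((hX₁' v).1 hv1).2 ⟨((hX₁' v).1 hv1).1, ((hX₂' v).1 hv2).1, ((hX₃' v).1 hv3).1⟩

/-- **Hub stripping for ALL pairwise-nested triples**: if `E₃(D[X₁|Y₁],D[X₂|Y₂],D[X₃|Y₃]) ≥ 0` for every weight function and every
hub-less pairwise-nested triple with far sides `Y₁, Y₂, Y₃`, then it holds for every pairwise-nested triple with these far sides. [this work] -/
theorem nonneg_of_hubless (Y₁ Y₂ Y₃ : List (Fin n))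
    (H : ∀ (w : Sym2 (Fin n) → unitInterval) (X₁ X₂ X₃ : List (Fin n)),
      (Y₁ ⊆ X₂ ∨ Y₂ ⊆ X₁) → (Y₁ ⊆ X₃ ∨ Y₃ ⊆ X₁) → (Y₂ ⊆ X₃ ∨ Y₃ ⊆ X₂) → (∀ v ∈ X₁, v ∈ X₂ → v ∉ X₃) →
      0 ≤ sahiE3 (prodBernoulli w) (connEvent (sep X₁ Y₁)) (connEvent (sep X₂ Y₂)) (connEvent (sep X₃ Y₃)))
    (w : Sym2 (Fin n) → unitInterval) (X₁ X₂ X₃ : List (Fin n))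
    (n₁₂ : Y₁ ⊆ X₂ ∨ Y₂ ⊆ X₁) (n₁₃ : Y₁ ⊆ X₃ ∨ Y₃ ⊆ X₁) (n₂₃ : Y₂ ⊆ X₃ ∨ Y₃ ⊆ X₂) :
    0 ≤ sahiE3 (prodBernoulli w) (connEvent (sep X₁ Y₁)) (connEvent (sep X₂ Y₂)) (connEvent (sep X₃ Y₃)) := by
  refine nonneg_of_hubless_class Y₁ Y₂ Y₃
    (fun X₁ X₂ X₃ => (Y₁ ⊆ X₂ ∨ Y₂ ⊆ X₁) ∧ (Y₁ ⊆ X₃ ∨ Y₃ ⊆ X₁) ∧ (Y₂ ⊆ X₃ ∨ Y₃ ⊆ X₂))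
    (fun _ _ _ h => h) ?_ ?_ ?_ ?_ (fun w X₁ X₂ X₃ hK hT => H w X₁ X₂ X₃ hK.1 hK.2.1 hK.2.2 hT) w X₁ X₂ X₃ ⟨n₁₂, n₁₃, n₂₃⟩
  · rintro X₁ X₂ X₃ z ⟨h12, h13, h23⟩
    exact ⟨h12.imp id fun h => (fun v hv => List.mem_cons_of_mem z (h hv)), h13.imp id fun h => (fun v hv => List.mem_cons_of_mem z (h hv)), h23⟩
  · rintro X₁ X₂ X₃ z ⟨h12, h13, h23⟩
    exact ⟨h12.imp (fun h => (fun v hv => List.mem_cons_of_mem z (h hv))) id, h13, h23.imp id fun h => (fun v hv => List.mem_cons_of_mem z (h hv))⟩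
  · rintro X₁ X₂ X₃ z ⟨h12, h13, h23⟩
    exact ⟨h12, h13.imp (fun h => (fun v hv => List.mem_cons_of_mem z (h hv))) id, h23.imp (fun h => (fun v hv => List.mem_cons_of_mem z (h hv))) id⟩
  · rintro X₁ X₂ X₃ X₁' X₂' X₃' ⟨h12, h13, h23⟩ hY hX₁' hX₂' hX₃'
    have s₁ : ∀ {S S' : List (Fin n)}, (∀ v, v ∈ S' ↔ v ∈ S ∧ ¬ (v ∈ X₁ ∧ v ∈ X₂ ∧ v ∈ X₃)) → Y₁ ⊆ S → Y₁ ⊆ S' :=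
      fun hS h q hq => (hS q).2 ⟨h hq, fun hT => (hY q hT).1 hq⟩
    have s₂ : ∀ {S S' : List (Fin n)}, (∀ v, v ∈ S' ↔ v ∈ S ∧ ¬ (v ∈ X₁ ∧ v ∈ X₂ ∧ v ∈ X₃)) → Y₂ ⊆ S → Y₂ ⊆ S' :=
      fun hS h q hq => (hS q).2 ⟨h hq, fun hT => (hY q hT).2.1 hq⟩
    have s₃ : ∀ {S S' : List (Fin n)}, (∀ v, v ∈ S' ↔ v ∈ S ∧ ¬ (v ∈ X₁ ∧ v ∈ X₂ ∧ v ∈ X₃)) → Y₃ ⊆ S → Y₃ ⊆ S' :=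
      fun hS h q hq => (hS q).2 ⟨h hq, fun hT => (hY q hT).2.2 hq⟩
    exact ⟨h12.imp (s₁ hX₂') (s₂ hX₁'), h13.imp (s₁ hX₃') (s₃ hX₁'), h23.imp (s₂ hX₃') (s₃ hX₂')⟩

/-! ### The cyclically decorated 3PT-LB family and row 37 -/

/-- **Hub stripping for the cyclically decorated 3PT-LB family** `CYC(P,Q,R) = E₃(D[P|c], D[Q|y], D[R|b])`, `b ∈ P`, `c ∈ Q`, `y ∈ R`
(3PT-LB: singletons; one decorated pole: hybrid 3PT-LB rows; `P=[a,b],Q=[a,c],R=[y]`: row 15; `P=[a,b],Q=[a,c],R=[a,y]`: row 37 of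
`…FrontierDecRowsLeFive`): nonnegativity of the hub-less members (no vertex common to `P, Q, R`) implies nonnegativity of all members.
[this work] -/
theorem cyc_nonneg_of_hubless (b c y : Fin n)
    (H : ∀ (w : Sym2 (Fin n) → unitInterval) (P Q R : List (Fin n)), b ∈ P → c ∈ Q → y ∈ R → (∀ v ∈ P, v ∈ Q → v ∉ R) →
      0 ≤ sahiE3 (prodBernoulli w) (connEvent (sep P [c])) (connEvent (sep Q [y])) (connEvent (sep R [b])))
    (w : Sym2 (Fin n) → unitInterval) (P Q R : List (Fin n)) (hb : b ∈ P) (hc : c ∈ Q) (hy : y ∈ R) :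
    0 ≤ sahiE3 (prodBernoulli w) (connEvent (sep P [c])) (connEvent (sep Q [y])) (connEvent (sep R [b])) := by
  have sub : ∀ {v : Fin n} {S : List (Fin n)}, v ∈ S → [v] ⊆ S := fun hv u hu => by
    rw [List.mem_singleton.1 hu]; exact hv
  refine nonneg_of_hubless_class [c] [y] [b] (fun P Q R => b ∈ P ∧ c ∈ Q ∧ y ∈ R) ?_ ?_ ?_ ?_ ?_
    (fun w P Q R hK hT => H w P Q R hK.1 hK.2.1 hK.2.2 hT) w P Q R ⟨hb, hc, hy⟩
  · rintro P Q R ⟨hb, hc, hy⟩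
    exact ⟨Or.inl (sub hc), Or.inr (sub hb), Or.inl (sub hy)⟩
  · rintro P Q R z ⟨hb, hc, hy⟩
    exact ⟨List.mem_cons_of_mem z hb, hc, hy⟩
  · rintro P Q R z ⟨hb, hc, hy⟩
    exact ⟨hb, List.mem_cons_of_mem z hc, hy⟩
  · rintro P Q R z ⟨hb, hc, hy⟩
    exact ⟨hb, hc, List.mem_cons_of_mem z hy⟩
  · rintro P Q R P' Q' R' ⟨hb, hc, hy⟩ hY hP' hQ' hR'
    exact ⟨(hP' b).2 ⟨hb, fun hT => (hY b hT).2.2 (List.mem_singleton.2 rfl)⟩,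
      (hQ' c).2 ⟨hc, fun hT => (hY c hT).1 (List.mem_singleton.2 rfl)⟩,
      (hR' y).2 ⟨hy, fun hT => (hY y hT).2.1 (List.mem_singleton.2 rfl)⟩⟩

/-- **Row 37 `(D[ab|c], D[ac|y], D[ay|b])` of `…FrontierDecRowsLeFive` for ALL `n` from the hub-less cyclically decorated 3PT-LB rows**
(row 37 is `CYC([a,b],[a,c],[a,y])`, hub `a`; by `sahiE3_hubEdge` it is an exact average of hub-less members on the graph with `a`'s pairs
closed).  All `n`, all weights, all `a b c y` (no distinctness needed); the hypothesis quantifies over the same vertex type `Fin n`. [this work] -/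
theorem frontier_37_of_cyc_hubless (w : Sym2 (Fin n) → unitInterval) (a b c y : Fin n)
    (H : ∀ (w : Sym2 (Fin n) → unitInterval) (P Q R : List (Fin n)), b ∈ P → c ∈ Q → y ∈ R → (∀ v ∈ P, v ∈ Q → v ∉ R) →
      0 ≤ sahiE3 (prodBernoulli w) (connEvent (sep P [c])) (connEvent (sep Q [y])) (connEvent (sep R [b]))) :
    0 ≤ sahiE3 (prodBernoulli w) (connEvent (FrontierDecRows.row 37 n (a, b, c, y)).1)
      (connEvent (FrontierDecRows.row 37 n (a, b, c, y)).2.1) (connEvent (FrontierDecRows.row 37 n (a, b, c, y)).2.2) := by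
  have hr : FrontierDecRows.row 37 n (a, b, c, y) = (sep [a, b] [c], sep [a, c] [y], sep [a, y] [b]) := rfl
  rw [hr]
  exact cyc_nonneg_of_hubless b c y H w [a, b] [a, c] [a, y] (by simp) (by simp) (by simp)

end HubStripping

end Summit.CriticalPhenomena.PercolationContinuityZ3.Theorems
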